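import Mathlib
import Literature.Computability.Complexity.RossmanMonotoneCliqueGraphs

/-!
# Union-bound arithmetic for `RamseyDense` at the threshold `⌈2 log₂ n⌉`

Stub `stub_unionArith` of the line `Sketch` for the crux
`Summit.PneNP.PneNP.Theses.RamseyUncertifiable.RamseyNotNP` (stmt-PneNP-9814): for every `M : ℕ`,
eventually in `n`,
`M · C(n, k) < 2^{C(k,2)}` where `k = Nat.clog 2 (n²) = ⌈log₂ n²⌉`.
This is the quantitative form of the Erdős 1947 union bound (Erdős, Bull. AMS 53 (1947);
Graham–Rothschild–Spencer, *Ramsey Theory*, §4.2 Thm 1): the expected number of homogeneous `k`-sets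
of a uniformly random graph on `n` vertices is `2·C(n,k)·2^{−C(k,2)} ≤ 2^{1+k/2}/k! → 0` at the
threshold, so for every `M` the ratio `C(n,k)/2^{C(k,2)}` is eventually below `1/M`; the lead glues it
with a clique count to get that all but a vanishing fraction of graphs on `Fin n` are `2`-Ramsey.

Proof (elementary `ℕ` arithmetic, the template being
`Summit.PneNP.PneNP.Theorems.two_mul_choose_lt_two_pow_choose_two`, the case `M = 2`):
* `(j+1)·2^{j+4} ≤ (j+4)!`, i.e. `(k−3)·2^k ≤ k!` for `k ≥ 4` (induction), hence `M·2^k < k!` once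
  `k ≥ M + 4`, hence `M²·2^k < (k!)²`;
* if moreover `n² ≤ 2^k` then `k!·C(n,k) = n(n−1)⋯(n−k+1) ≤ n^k` gives
  `(k!·C(n,k))² ≤ (2^k)^k = 2^{2·C(k,2)}·2^k` (`2·C(k,2) + k = k²`,
  `Literature.Computability.Complexity.two_mul_choose_two_add`), so
  `(M·C(n,k))²·(k!)² ≤ M²·2^{2C(k,2)}·2^k < (2^{C(k,2)})²·(k!)²`, cancel and take square roots;
* at `k := Nat.clog 2 (n²)` we have `n² ≤ 2^k` (`Nat.le_pow_clog`) and `k ≥ M + 4` as soon as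
  `n ≥ 2^{M+4}` (`Nat.lt_clog_iff_pow_lt`).
-/

-- the namespace `Summit.PneNP.PneNP.Theorems.…` (summit = sub-problem `PneNP`) is prescribed by the tree layout
set_option linter.dupNamespace false

namespace Summit.PneNP.PneNP.Theorems.RamseyNotNP.TypicalCapture

/-- `(j+1)·2^{j+4} ≤ (j+4)!` for every `j`, i.e. `(k−3)·2^k ≤ k!` for `k ≥ 4` (at `j = 0`: `16 ≤ 24`;
step: `2(j+2) ≤ (j+5)(j+1)`). -/
theorem unionArith_succ_mul_two_pow_le_factorial (j : ℕ) :
    (j + 1) * 2 ^ (j + 4) ≤ Nat.factorial (j + 4) := by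
  induction j with
  | zero => decide
  | succ j ih =>
    rw [show j + 1 + 4 = (j + 4) + 1 from rfl, Nat.factorial_succ, pow_succ]
    calc (j + 1 + 1) * (2 ^ (j + 4) * 2) = (2 * j + 4) * 2 ^ (j + 4) := by ring
      _ ≤ ((j + 4 + 1) * (j + 1)) * 2 ^ (j + 4) := by
        apply Nat.mul_le_mul_right
        nlinarith
      _ = (j + 4 + 1) * ((j + 1) * 2 ^ (j + 4)) := by ring
      _ ≤ (j + 4 + 1) * Nat.factorial (j + 4) := Nat.mul_le_mul_left _ ih

/-- `M·2^k < k!` whenever `k ≥ M + 4`. -/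
theorem unionArith_mul_two_pow_lt_factorial {M k : ℕ} (hk : M + 4 ≤ k) :
    M * 2 ^ k < Nat.factorial k := by
  obtain ⟨j, rfl⟩ : ∃ j, k = j + 4 := ⟨k - 4, by omega⟩
  calc M * 2 ^ (j + 4) < (j + 1) * 2 ^ (j + 4) :=
        Nat.mul_lt_mul_of_pos_right (by omega) (Nat.two_pow_pos _)
    _ ≤ Nat.factorial (j + 4) := unionArith_succ_mul_two_pow_le_factorial j

/-- The union-bound count with an arbitrary multiplier: if `k ≥ M + 4` and `n² ≤ 2^k` then
`M·C(n,k) < 2^{C(k,2)}` (compare squares: `(M·C(n,k))²·(k!)² ≤ M²·2^{k²} = 2^{2C(k,2)}·(M²·2^k) <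
2^{2C(k,2)}·(k!)²`). -/
theorem unionArith_mul_choose_lt_two_pow_choose_two {M n k : ℕ} (hk : M + 4 ≤ k)
    (hn : n ^ 2 ≤ 2 ^ k) : M * n.choose k < 2 ^ k.choose 2 := by
  -- `k!·C(n,k) ≤ n^k`, hence `(k!·C(n,k))² ≤ (n²)^k ≤ 2^{k²}`
  have h1 : Nat.factorial k * n.choose k ≤ n ^ k := by
    rw [← Nat.descFactorial_eq_factorial_mul_choose]
    exact Nat.descFactorial_le_pow n k
  have h2 : (Nat.factorial k * n.choose k) ^ 2 ≤ 2 ^ (k * k) := by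
    calc (Nat.factorial k * n.choose k) ^ 2 ≤ (n ^ k) ^ 2 := Nat.pow_le_pow_left h1 2
      _ = (n ^ 2) ^ k := by ring
      _ ≤ (2 ^ k) ^ k := Nat.pow_le_pow_left hn k
      _ = 2 ^ (k * k) := by rw [← pow_mul]
  -- `M²·2^k ≤ (M·2^k)² < (k!)²`
  have h3 : M ^ 2 * 2 ^ k < (Nat.factorial k) ^ 2 := by
    calc M ^ 2 * 2 ^ k ≤ M ^ 2 * (2 ^ k) ^ 2 :=
          Nat.mul_le_mul_left _ (Nat.le_self_pow two_ne_zero _)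
      _ = (M * 2 ^ k) ^ 2 := by ring
      _ < (Nat.factorial k) ^ 2 :=
          Nat.pow_lt_pow_left (unionArith_mul_two_pow_lt_factorial hk) two_ne_zero
  have h4 : 2 * k.choose 2 + k = k * k :=
    Literature.Computability.Complexity.two_mul_choose_two_add k
  -- compare squares: `(M·C(n,k))²·(k!)² ≤ M²·2^{k²} < (2^{C(k,2)})²·(k!)²`
  have hsq : (M * n.choose k) ^ 2 * (Nat.factorial k) ^ 2 <
      (2 ^ k.choose 2) ^ 2 * (Nat.factorial k) ^ 2 := by
    have hkk : 2 ^ (k * k) = 2 ^ (2 * k.choose 2) * 2 ^ k := by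
      rw [← pow_add, h4]
    calc (M * n.choose k) ^ 2 * (Nat.factorial k) ^ 2
        = M ^ 2 * (Nat.factorial k * n.choose k) ^ 2 := by ring
      _ ≤ M ^ 2 * 2 ^ (k * k) := Nat.mul_le_mul_left _ h2
      _ = 2 ^ (2 * k.choose 2) * (M ^ 2 * 2 ^ k) := by rw [hkk]; ring
      _ < 2 ^ (2 * k.choose 2) * (Nat.factorial k) ^ 2 := by gcongr
      _ = (2 ^ k.choose 2) ^ 2 * (Nat.factorial k) ^ 2 := by rw [← pow_mul, mul_comm (k.choose 2) 2]
  have hsq' : (M * n.choose k) ^ 2 < (2 ^ k.choose 2) ^ 2 := Nat.lt_of_mul_lt_mul_right hsq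
  exact (Nat.pow_lt_pow_iff_left (by norm_num)).1 hsq'

/-- **Stub B — union-bound arithmetic at the threshold.** For every `M : ℕ` there is `n₀` (namely
`2^{M+4}`) such that for all `n ≥ n₀`, with `k := Nat.clog 2 (n²) = ⌈2 log₂ n⌉`,
`M · C(n, k) < 2^{C(k,2)}`: the Erdős 1947 expected count of homogeneous `k`-sets, scaled by any fixed
`M`, is eventually `< 1` (Erdős 1947; Graham–Rothschild–Spencer §4.2 Thm 1). -/
theorem stub_unionArith :
    ∀ M : ℕ, ∃ n₀ : ℕ, ∀ n ≥ n₀,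
      M * n.choose (Nat.clog 2 (n ^ 2)) < 2 ^ (Nat.clog 2 (n ^ 2)).choose 2 := by
  intro M
  refine ⟨2 ^ (M + 4), fun n hn => ?_⟩
  -- `n² ≤ 2^k` and `k ≥ M + 4` since `2^{M+3} < 2^{M+4} ≤ n ≤ n²`
  have hnk : n ^ 2 ≤ 2 ^ Nat.clog 2 (n ^ 2) := Nat.le_pow_clog one_lt_two (n ^ 2)
  have hk : M + 4 ≤ Nat.clog 2 (n ^ 2) := by
    have h1 : 2 ^ (M + 3) < 2 ^ (M + 4) := Nat.pow_lt_pow_right (by norm_num) (by omega)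
    have h2 : n ≤ n ^ 2 := Nat.le_self_pow two_ne_zero n
    have h : M + 3 < Nat.clog 2 (n ^ 2) := (Nat.lt_clog_iff_pow_lt one_lt_two).2 (by omega)
    omega
  exact unionArith_mul_choose_lt_two_pow_choose_two hk hnk

end Summit.PneNP.PneNP.Theorems.RamseyNotNP.TypicalCapture
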